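import Summits.PneNP.PneNP.Theses.ConvexRankGates
import Summits.PneNP.PneNP.Theorems.LinAlgGateBlind.Negative.OnePermGate
import Summits.PneNP.PneNP.Theorems.LinAlgGateBlind.Negative.DetGate
import Summits.PneNP.PneNP.Theorems.LinAlgGateBlind.Negative.CliquePolyDetRepr
import Literature.Computability.Complexity.ExtMonotoneGates
import Literature.Computability.Complexity.CircuitLowerBounds
import Literature.Computability.Complexity.BCSP
import Literature.Computability.MetaComplexity.PolynomialCalculus

/-!
# Line `perm-door-lifted-closure-programs` for the crux `LinAlgGateBlind` (stmt-PneNP-10681)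

Crux (route `ConvexRankGates`, rank 4):
`Summit.PneNP.PneNP.Theses.ConvexRankGates.LinAlgGateBlind` —
`∃ δ ∈ (0,1/2), ∀ c, ∀ᶠ m, no circuit with ≤ m^c gates over {∧₂,∨₂} ∪ PERM_{m^c} ∪ GRANK_{m^c}
computes CLIQUE(m, ⌈m^δ⌉₊)` (read back below as `linAlgGateBlind_iff_hardClique`, `Iff.rfl`).

## The line (idea card `perm-door-lifted-closure-programs`, ideator 3, passed by all three r1 triagers)

LEVER (i) RELOCATE. The crux is worst-case, so it suffices to beat the circuits on a monotone
PROJECTION of CLIQUE. For every Boolean CSP `φ` of arity `w` (tree: `Expander.BCSP w`) and every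
domain size `q`, the GKRS monotone function `liftSat φ q` ("lifted CSP-SAT": input bit `s (j, a)` =
"local assignment `a : Fin w → Fin q` is ALLOWED at constraint `j`"; output `1` iff some global
`α : Fin nV → Fin q` is allowed everywhere) is the restriction of `CLIQUE(m, #constraints + D + 1)`
along the HUB PLANTING (hub `h`, one vertex group per constraint, `D ≥ 1` dummy groups, isolated
padding; `h ~ (j,a) := s (j,a)`, `(j,a) ~ (j',a') := [j ≠ j' ∧ a, a' consistent on shared
variables ∧ both self-consistent]`, dummies adjacent to everything self-consistent, all other edges
`0`): a clique meets each group at most once, hence is `h` + one allowed, pairwise consistent local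
assignment per constraint + the dummies, and pairwise consistency glues to a global `α`.
Constants are basis gates at every budget (`Disproof.const_isOver_basis`), so a size-`m^c` crux
circuit for CLIQUE yields a size-`m^c + 2` crux circuit for `liftSat` — `stub_transfer`
(= the card's `Transfer: C⁺ ⇒ crux`, provable now).

LEVER (ii) RANK AS A POTENTIAL IN THE DAG SIMULATION (single field). For an unsatisfiable `φ` that is
hard for polynomial calculus over the field `𝔽` (degree `≥ N^ε`, tree: `PC.RefutableInDegree` on the
standard falsified-local-assignment polynomials `axiomPolys 𝔽 φ`), the lifted function
`liftSat φ ((N+2)^b)` should be hard for `{∧₂,∨₂} ∪ SPAN_𝔽(N^c)` circuits (monotone span-program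
gates over `𝔽` of dimension `≤ N^c`, arbitrary arity): run the Garg–Göös–Kamath–Sokolov
structure-vs-density walk down the rectangle dag with the Nullstellensatz design as Delayer for
every node type, and certify a good child at a span node by the `𝔽`-rank of the Pitassi–Robere
lifted matrix on the current structured rectangle, through Gál's labelled rank-one decomposition
(`LabelledRankMeasure`, `stub_labelledRankMeasure`: `rank A ≤ Σ_rows rank (A ∘ 1_{R_row})`, the
dimension bound entering as the number of rows after de-duplication `≤ d · #children`) and the two
named open lemmas P1′ (robust rank dichotomy) / P2 (rank extraction from block-wise dense
rectangles). This is `stub_spanDagLift` — the LOAD-BEARING stub, = GKRS19 open problem (3) /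
"dag-like lifting for Res + NS_𝔽", generalising GGKS18 (no span gates) and PR18 (one span gate).

RESIDUES (the doors this lever does NOT open, each a named stub so that the skeleton concludes the
crux as typed; all three triage notes record that every PERM-side line leaves them):
* `stub_crossCharacteristic` (O1x): span gates of DIFFERENT characteristics in one circuit — the
  potential is a rank over ONE field; minimal uncharted instance "AND of an 𝔽₂- and an 𝔽₃-span
  program". Stated for lifts of CSPs that are PC-hard over EVERY field (for general families the
  upgrade is false: `A(x) ∧ B(y)` with `A` 𝔽₂-easy and `B` 𝔽₃-easy).
* `stub_permLinearisation` (O2)+(O3): PERM gates (nonabelian groups, `ℤ/p^k`-modules) add no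
  superpolynomial power to mixed-field span circuits — the circuit form of the Linearisation
  Conjecture of crux idea `invariant-module-linearisation` (membership = poly many section-module
  fixed-vector tests = `{∧,∨}`-combinations of span programs); shadowed by
  `Literature.Barriers.PneNP.CompositeModulusDegree` for `ℤ/4`, `ℤ/6`.
* `stub_grankDoor`: GRANK gates on the planted instance — Valiant-hard by the Disproof headline
  `dc_cliquePoly_superpolynomial_of_linAlgGateBlind` (the planted polynomial `Σ_α Π_j s_{j,α|j}` is
  permanent-like); NOT claimed by this line, isolated here so that nothing else depends on it.
* `stub_allFieldHardCSP`: the INPUT — an explicit bounded-arity unsatisfiable Boolean CSP family of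
  polynomial size with PC degree `≥ N^ε` over every field simultaneously (graph-PHP / functional PHP
  on bounded-degree bipartite expanders: Razborov 1998, Alekhnovich–Razborov 2003, Mikša–Nordström
  2015; in tree only the wide-clause `PC.negWPHP` with `PC.Razborov1998_PC_negWPHP_degree`).
  Literature, formalisation only.

Composition (`LinAlgGateBlind_of`, fully proved from the seven sorried stubs; `LinAlgGateBlind_of_hypotheses` is the same proof with the seven stub STATEMENTS as hypotheses, standard axioms only):
hard CSP family `F` (S2) → for every field, single-field span hardness of `liftFamily F b` (S3, fed
by S7) → mixed-field span hardness (S4) → + PERM (S5) → + GRANK (S6) → antitone to the crux basis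
`{∧₂,∨₂} ∪ PERM ∪ GRANK ⊆ {∧₂,∨₂} ∪ SPAN_* ∪ PERM ∪ GRANK` → `LinAlgGateBlind` (S1).

Disproof items honoured (gen 2, `Cruxes/LinAlgGateBlind/Disproof.lean`): `not_withoutBasis` /
`not_withoutSizeBound` (every hardness statement is `IsOver … → size ≤ N^c → ¬Computes`);
`not_withoutPermDim` / `not_withoutGRankDim` / `not_blindDim_pow_kOf` (span DIMENSION `d ≤ N^c` is
charged: it is the factor in `LabelledRankMeasure` after row de-duplication; one span gate of
dimension `q^{nV}` computes `liftSat` exactly, so S3 is false without it); `not_blindConstK` and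
`not_uniformThreshold` (clique size `#constraints + D + 1 → ∞` with `N`; all statements `∀ c, ∀ᶠ N`);
`blind_window` (S1 picks `δ` inside `(0,1/2)`); `const_isOver_basis` (used by the planting);
headline (b) priced into `stub_grankDoor` only; target kill `Sketch3Copy.not_shadowCliqueCover`
concerns the companion card, not this line. Negative lemmas imported and checked against:
`Negative.OnePermGate`, `Negative.DetGate`, `Negative.CliquePolyDetRepr` (one-gate constructions live
at dimension `m^{Θ(k)}`; no stub asserts blindness at such budgets).
-/

set_option linter.dupNamespace false

namespace Summit.PneNP.PneNP.Cruxes.LinAlgGateBlind.PermDoorLiftedClosurePrograms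

open Literature.Computability.Complexity Literature.Computability.MetaComplexity Filter Finset
open Literature.Computability.Complexity.Expander (BCSP)
open Summit.PneNP.PneNP.Theses.ConvexRankGates (LinAlgGateBlind)
open scoped Classical BigOperators

noncomputable section

/-! ## Gate classes and bases -/

/-- **Span gates over the field `𝔽` of dimension `≤ s`** (monotone span programs as ONE gate): one row
`row i ∈ 𝔽^d` per input wire (arity unbounded, rows repeatable), a target `t ∈ 𝔽^d`, `d ≤ s`; the gate
accepts `v` iff `t ∈ span_𝔽 {row i : v i = 1}`. Over `𝔽 = ZMod p` these are abelian PERM gates on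
`p·d` points (`(ℤ/p)^d ↪ Sym(p d)`); over infinite `𝔽` they are not PERM gates. [Karchmer–Wigderson 1993;
Krajíček 2019 §18.3] -/
def IsSpanGate (𝔽 : Type) [Field 𝔽] (s : ℕ) (g : GateFn) : Prop :=
  ∃ d : ℕ, d ≤ s ∧ ∃ (row : Fin g.1 → (Fin d → 𝔽)) (t : Fin d → 𝔽),
    ∀ v : Fin g.1 → Bool, g.2 v = true ↔ t ∈ Submodule.span 𝔽 (row '' {i | v i = true})

/-- Span gates of dimension `≤ s` over SOME field (characteristics may differ from gate to gate). -/
def IsSomeSpanGate (s : ℕ) (g : GateFn) : Prop := ∃ (𝔽 : Type) (_ : Field 𝔽), IsSpanGate 𝔽 s g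

/-- The monotone basis `{∧₂, ∨₂}` (= `monotoneBasis`, spelled as in the route file). -/
def andOr : Set GateFn := {GateFn.and 2, GateFn.or 2}

/-- `{∧₂, ∨₂} ∪ SPAN_𝔽(s)`: single-field span circuits — the model of the load-bearing stub. -/
def spanBasis (𝔽 : Type) [Field 𝔽] (s : ℕ) : Set GateFn := andOr ∪ {g | IsSpanGate 𝔽 s g}

/-- `{∧₂, ∨₂} ∪ ⋃_𝔽 SPAN_𝔽(s)`: mixed-field span circuits. -/
def allSpanBasis (s : ℕ) : Set GateFn := andOr ∪ {g | IsSomeSpanGate s g}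

/-- `{∧₂, ∨₂} ∪ ⋃_𝔽 SPAN_𝔽(s) ∪ PERM_s`. -/
def allSpanPermBasis (s : ℕ) : Set GateFn := allSpanBasis s ∪ {g | IsPermGate s g}

/-- `{∧₂, ∨₂} ∪ ⋃_𝔽 SPAN_𝔽(s) ∪ PERM_s ∪ GRANK_s` — contains the crux's basis. -/
def allSpanLinBasis (s : ℕ) : Set GateFn := allSpanPermBasis s ∪ {g | IsGRankGate s g}

/-- The crux's basis `{∧₂, ∨₂} ∪ PERM_s ∪ GRANK_s`, literally the route's inline `let Lin` (the texts
of `IsPermGate`/`IsGRankGate` ARE the route's inline disjuncts; cf. `Disproof.linAlgGateBlind_iff`). -/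
def cruxBasis (s : ℕ) : Set GateFn := andOr ∪ {g | IsPermGate s g ∨ IsGRankGate s g}

theorem cruxBasis_subset_allSpanLinBasis (s : ℕ) : cruxBasis s ⊆ allSpanLinBasis s := by
  rintro g (hg | hg | hg)
  · exact Or.inl (Or.inl (Or.inl hg))
  · exact Or.inl (Or.inr hg)
  · exact Or.inr hg

/-! ## Superpolynomial hardness of a function family against a budgeted basis -/

/-- `HardAgainst B ι f`: for every exponent `c`, eventually in `N`, no circuit over `B (N^c)` with at
most `N^c` gates computes `f N : (ι N → Bool) → Bool`. (Exactly the quantifier shape of the crux, with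
the instance size `N` in place of `m`.) -/
def HardAgainst (B : ℕ → Set GateFn) (ι : ℕ → Type) (f : ∀ N, (ι N → Bool) → Bool) : Prop :=
  ∀ c : ℕ, ∀ᶠ N : ℕ in atTop, ∀ C : Circuit (ι N),
    C.IsOver (B (N ^ c)) → C.size ≤ N ^ c → ¬ C.Computes (f N)

/-- Hardness against a larger basis is hardness against a smaller one. [folklore] -/
theorem HardAgainst.anti {B B' : ℕ → Set GateFn} (hBB' : ∀ s, B s ⊆ B' s) {ι : ℕ → Type}
    {f : ∀ N, (ι N → Bool) → Bool} (h : HardAgainst B' ι f) : HardAgainst B ι f := by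
  intro c
  filter_upwards [h c] with N hN C hC hs
  exact hN C (hC.mono (hBB' _)) hs

/-- READ-BACK: the crux is `HardAgainst`-shaped hardness of `CLIQUE(m, ⌈m^δ⌉₊)` against `cruxBasis`,
by `Iff.rfl` (inline gate classes = `IsPermGate`/`IsGRankGate`, inline clique function = `cliqueFn`). -/
theorem linAlgGateBlind_iff_hardClique :
    LinAlgGateBlind ↔ ∃ δ : ℝ, 0 < δ ∧ δ < 1 / 2 ∧ ∀ c : ℕ, ∀ᶠ m : ℕ in atTop,
      ∀ C : Circuit ((⊤ : SimpleGraph (Fin m)).edgeSet), C.IsOver (cruxBasis (m ^ c)) →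
        C.size ≤ m ^ c → ¬ C.Computes (cliqueFn m ⌈(m : ℝ) ^ δ⌉₊) :=
  Iff.rfl

/-! ## Lifted CSP-SAT (the planted function) and the algebraic hardness input -/

variable {w : ℕ}

/-- Input type of lifted CSP-SAT for the Boolean CSP `φ` of arity `w` and domain size `q`: one bit per
(constraint `j`, local assignment `a : Fin w → Fin q` of the `w` positions read by `j`). -/
abbrev LiftIn (φ : BCSP w) (q : ℕ) : Type := Fin φ.cons.length × (Fin w → Fin q)

/-- **Lifted CSP-SAT** (Göös–Kamath–Robere–Sokolov's `CSP-SAT` on the scopes of `φ` over the domain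
`Fin q`): `s ↦ [∃ α : Fin nV → Fin q, every constraint j ALLOWS the local assignment α ∘ vars j]`.
Monotone in `s`; depends on `φ` only through its scopes. With `q = poly`, Alice's pointers / Bob's
gadget tables of `S(φ) ∘ IND_q^{nV}` map to accepted / rejected inputs, so its monotone KW game embeds
the lifted search problem. [GoosKamathRobereSokolov2019, §5; GargGoosKamathSokolov2018] -/
def liftSat (φ : BCSP w) (q : ℕ) (s : LiftIn φ q → Bool) : Bool :=
  decide (∃ α : Fin φ.nV → Fin q, ∀ j : Fin φ.cons.length, s (j, α ∘ φ.vars j) = true)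

/-- Index types of the planted family: instance `N` of `F`, domain size `(N+2)^b`. -/
def LiftIdx (F : ℕ → BCSP w) (b : ℕ) : ℕ → Type := fun N => LiftIn (F N) ((N + 2) ^ b)

/-- The planted family `N ↦ liftSat (F N) ((N+2)^b)`. -/
def liftFamily (F : ℕ → BCSP w) (b : ℕ) : ∀ N, (LiftIdx F b N → Bool) → Bool :=
  fun N => liftSat (F N) ((N + 2) ^ b)

/-- Polynomial size of a CSP family: `≤ (N+2)^a` variables and constraints. -/
def PolySize (a : ℕ) (F : ℕ → BCSP w) : Prop :=
  ∀ N, (F N).nV ≤ (N + 2) ^ a ∧ (F N).cons.length ≤ (N + 2) ^ a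

/-- `[x = b]` as a polynomial: `X x` for `b = 1`, `1 - X x` for `b = 0`. -/
def litPoly {n : ℕ} (𝔽 : Type) [Field 𝔽] (x : Fin n) (b : Bool) : MvPolynomial (Fin n) 𝔽 :=
  if b then MvPolynomial.X x else 1 - MvPolynomial.X x

/-- The standard polynomial translation of constraint `j` of `φ`: the sum, over the local assignments
`a` REJECTED by `j`, of the indicator monomial `∏_t [x_{vars j t} = a t]`; on Boolean points it is `1`
iff the constraint is violated, so the axiom is `axiomPoly = 0` (for a clause: the usual
`∏ (falsified literals)`; degree `≤ w`). [Krajíček 2019 (6.0.1); AlekhnovichRazborov2003 §2] -/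
def axiomPoly (𝔽 : Type) [Field 𝔽] (φ : BCSP w) (j : Fin φ.cons.length) :
    MvPolynomial (Fin φ.nV) 𝔽 :=
  ∑ a ∈ (univ : Finset (Fin w → Bool)).filter (fun a => φ.acc j a = false),
    ∏ t : Fin w, litPoly 𝔽 (φ.vars j t) (a t)

/-- The polynomial system of `φ` over `𝔽` (Boolean axioms are built into `PC.DerivableInDegree`). -/
def axiomPolys (𝔽 : Type) [Field 𝔽] (φ : BCSP w) : Set (MvPolynomial (Fin φ.nV) 𝔽) :=
  Set.range (axiomPoly 𝔽 φ)

/-! ## Gál's rank measure with labels (the certificate used at span nodes) -/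

/-- **Labelled rank measure** (Gál 2001, labels generalised; triage-verified): if a span program over
`F` whose rows are switched on by arbitrary monotone label functions `lab i` accepts exactly `f⁻¹(1)`,
then for all `U ⊆ f⁻¹(1)`, `V ⊆ f⁻¹(0)` and every matrix `A` on `U × V`,
`rank A ≤ Σ_i rank (A ∘ 1[lab i u = 1 ∧ lab i v = 0])`. Proof: accepted `u` gives
`t = Σ_i c_i(u) row_i` on switched-on rows; rejected `v` gives a functional `d_v` killing `v`'s rows
with `d_v(t) = 1`; `J = Σ_i D_i`, `D_i[u,v] = c_i(u) d_v(row_i)` rank one and supported on the `i`-th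
label rectangle, so `A = Σ_i A ∘ D_i` with `rank (A ∘ D_i) ≤ rank (A ∘ 1_{R_i})`. In the dag walk the
labels are the CHILDREN's wire functions; after replacing each child's rows by a basis of their span
the number of rows is `≤ d · #children`, which is how the dimension bound `d ≤ N^c` is charged.
[Gal2001 (doi:10.1007/s000370100001); Razborov1990 rank measure] -/
def LabelledRankMeasure : Prop :=
  ∀ (F : Type) [Field F] (ι : Type) [Fintype ι] (d R : ℕ) (rows : Fin R → (Fin d → F))
    (lab : Fin R → ((ι → Bool) → Bool)) (t : Fin d → F) (f : (ι → Bool) → Bool),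
    (∀ i, Monotone (lab i)) →
    (∀ x, f x = true ↔ t ∈ Submodule.span F (rows '' {i | lab i x = true})) →
    ∀ (U V : Finset (ι → Bool)), (∀ u ∈ U, f u = true) → (∀ v ∈ V, f v = false) →
      ∀ A : Matrix U V F,
        A.rank ≤ ∑ i, (Matrix.of fun (u : U) (v : V) =>
          if lab i u = true ∧ lab i v = false then A u v else 0).rank

/-! ## The registered stubs -/

/-- **stub_transfer — RELOCATE / hub planting (the card's `Transfer: C⁺ ⇒ crux`; PROVABLE NOW, L).**
For every Boolean CSP family `F` of arity `w` with `≤ (N+2)^a` variables and constraints and every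
gadget exponent `b`: if the planted family `liftFamily F b` is superpolynomially hard against the
crux's own basis `{∧₂,∨₂} ∪ PERM ∪ GRANK`, then `LinAlgGateBlind`. PROOF ROUTE: pick `δ := 1/4`
(any `δ ∈ (0,1/2)` works); given `c` and large `m`, set `k := ⌈m^δ⌉₊` and
`N := N(m) := ⌊m^γ⌋₊ − 2` with `γ := min (δ/a) (1/(4 b w + 4))` so that
`#constraints(F N) ≤ (N+2)^a ≤ k − 2` and `1 + (k−1)·(N+2)^{b w} + k ≤ m`; plant: vertices = hub ⊕
`LiftIn (F N) ((N+2)^b)` ⊕ `D := k − 1 − #constraints ≥ 1` dummies ⊕ isolated padding ≃ `Fin m`;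
restrict a CLIQUE(m,k) circuit with `Circuit.mapInputs`/constant gates (`CircuitInputMap`,
`Disproof.const_isOver_basis`: `true`/`false` ∈ PERM(0)/GRANK(0)) along hub edge `{h,(j,a)} ↦ input
(j,a)`, consistency/dummy edges ↦ constants; prove `cliqueFn m k ∘ plant = liftSat` (a `k`-clique has
≤ 1 vertex per group ⇒ hub + `D` dummies + one allowed, self-consistent, pairwise consistent local
assignment per constraint ⇒ a global `α`, free variables arbitrary since `(N+2)^b ≥ 1`; conversely
`α` gives the clique); sizes: `m^c + 2 ≤ N^{c'}` and `cruxBasis (m^c) ⊆ cruxBasis (N^{c'})`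
(`IsPermGate.mono`, `IsGRankGate.mono`) for `c' = O(c/γ)`, and `N(m) → ∞` meets the `∀ᶠ N` of the
hypothesis. If `HardAgainst` holds vacuously-false cases (`liftSat` constant) the implication is
trivial, so no side condition is needed. [GoosKamathRobereSokolov2019 §5 (CSP-SAT); this card §(2)] -/
theorem stub_transfer (w a b : ℕ) (F : ℕ → BCSP w) (hsize : PolySize a F)
    (h : HardAgainst cruxBasis (LiftIdx F b) (liftFamily F b)) : LinAlgGateBlind := by
  sorry

/-- **stub_allFieldHardCSP — the hardness input (KNOWN; formalisation L).** There is a Boolean CSP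
family of bounded arity and polynomial size, eventually unsatisfiable, whose polynomial translation has
NO polynomial-calculus refutation of degree `≤ N^ε` over ANY field, uniformly in the field. Witnesses
in print: the pigeonhole principle `PHP^{N+1}_N` restricted to a bounded-degree bipartite expander
(graph-PHP / functional PHP: pigeon axioms of width `Δ = O(1)`, hole axioms of width 2, padded to arity
`w = Δ` by repeating a position) — PC degree `Ω(N)` over every field (Mikša–Nordström 2015 Thm 1.1–1.2,
after Alekhnovich–Razborov 2003 and Razborov 1998 `deg > N/2` for the wide-clause version, in tree as
the named fact `PC.Razborov1998_PC_negWPHP_degree` for `PC.negWPHP`); random `O(1)`-CNF of linear size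
also works (AR03, expansion only). Existence of the expander by counting or explicitly. Why it might
fail: only by mis-translation (`axiomPoly` is the falsified-local-assignment indicator; for clauses it
is Krajíček's (6.0.1)); the graph-PHP degree bound over fields of characteristic dividing small
numbers must be taken from MN15/AR03, not from Razborov's `(n-t)!/n!` design. [MiksaNordstrom2015;
AlekhnovichRazborov2003; Razborov1998; BenSassonWigderson2001] -/
theorem stub_allFieldHardCSP : ∃ (w a : ℕ) (F : ℕ → BCSP w), PolySize a F ∧
    (∀ᶠ N : ℕ in atTop, ¬ (F N).Sat) ∧
    ∃ ε : ℝ, 0 < ε ∧ ∀ᶠ N : ℕ in atTop, ∀ (𝔽 : Type) [Field 𝔽],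
      ¬ PC.RefutableInDegree (axiomPolys 𝔽 (F N)) ⌊(N : ℝ) ^ ε⌋₊ := by
  sorry

/-- **stub_spanDagLift — dag-like lifting for `{∧₂,∨₂} ∪ SPAN_𝔽` (LOAD-BEARING; OPEN = GKRS19 open
problem (3), "Res + NS_𝔽 dag-lifting").** Given Gál's labelled rank measure: for every arity `w` and
size exponent `a` there is a gadget exponent `b` (field-independent, as in GGKS18/PR18) such that for
every field `𝔽` and every polynomial-size, eventually unsatisfiable CSP family `F` whose translation
needs PC/𝔽 degree `> N^ε`, the planted family `N ↦ liftSat (F N) ((N+2)^b)` is superpolynomially hard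
for circuits over `{∧₂,∨₂} ∪ SPAN_𝔽(N^c)` (span gates over THIS field, dimension `≤ N^c`, any arity).
Known end-points: no span gates — GGKS18 (resolution width `≥` PC degree − 1 lifts to monotone circuit
size `q^{Ω(D)}`); one span gate = the whole device — PR18/GKRS19 (NS_𝔽 degree lifts to mSP_𝔽 size /
rank measure). MECHANISM for the mixed dag: GGKS walk with the NS design `E` as Delayer at every node
(binary node: `E[1_ρ] = E[1_ρ z] + E[1_ρ (1−z)]` keeps one child consistent); at a span node with
children `c₁..c_r`, `stub_labelledRankMeasure` gives `rank A|_{X×Y} ≤ Σ_rows rank (A ∘ 1_{R_c(row)})`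
(`≤ d·(size+inputs)` rows after de-duplication), so if NO child rectangle contained a structured
consistent sub-rectangle each summand would be small (P1′: robust rank dichotomy — a rectangle
decomposing into structured pieces with inconsistent pointers has small rank of the lifted design
matrix) while the left side is large (P2: rank extraction from block-wise dense consistent rectangles;
true for product rectangles, open for non-product ones) — contradiction, walk continues; leaves are
killed by consistency. Why it might fail: P2 for non-product dense rectangles (cheapest falsifier: an
𝔽₂-bilinear / IND gadget at `p = 2`, exhaustive search `nV ≤ 6`, `q ≤ 4`, PHP³₂); an unrestricted
poly-size dag-like Res(lin_𝔽) refutation of graph-PHP would remove the proof-complexity reason to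
believe it (only regular / bounded-depth fragments are lower-bounded as of 2026). Dimension is
load-bearing (`Disproof.not_withoutPermDim`: one span gate of dimension `q^{nV}` computes `liftSat`).
[GargGoosKamathSokolov2018; PitassiRobere2018 (doi:10.1145/3188745.3188914);
GoosKamathRobereSokolov2019; Gal2001; Sokolov2017] -/
theorem stub_spanDagLift (hLRM : LabelledRankMeasure) (w a : ℕ) : ∃ b : ℕ,
    ∀ (𝔽 : Type) [Field 𝔽] (F : ℕ → BCSP w), PolySize a F → (∀ᶠ N : ℕ in atTop, ¬ (F N).Sat) →
      (∃ ε : ℝ, 0 < ε ∧ ∀ᶠ N : ℕ in atTop,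
        ¬ PC.RefutableInDegree (axiomPolys 𝔽 (F N)) ⌊(N : ℝ) ^ ε⌋₊) →
      HardAgainst (spanBasis 𝔽) (LiftIdx F b) (liftFamily F b) := by
  sorry

/-- **stub_crossCharacteristic — (O1x), mixing characteristics (RESIDUE; OPEN, no lever in this line).**
For a CSP family that is PC-hard over EVERY field (uniformly) and whose lift is hard for single-field
span circuits over every field, the lift is hard for circuits mixing span gates of different fields.
The single-field rank potential cannot do this (a potential over `𝔽₂` is blind at an `𝔽₃`-node, and
one NS design cannot Delay for two characteristics at a binary node: the consistent child may differ).
The all-field hypothesis is essential: for GENERAL families the upgrade is presumably false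
(`A(x) ∧ B(y)` with `A` = lifted XOR-SAT mod 2 — ONE 𝔽₂-span gate, but PC-hard over every field of
characteristic ≠ 2 (Buss–Grigoriev–Impagliazzo–Pitassi 2001), hence hard for `{∧,∨} ∪ SPAN_𝔽`,
char 𝔽 ≠ 2, granted `stub_spanDagLift` — and `B` the same mod 3: size 3 mixed, hard field by field).
Why it might fail: a genuinely cross-characteristic monotone algorithm for lifted graph-PHP (none known;
CRT-type splittings need a modulus structure PHP lacks); evidence for: PHP is hard for PC over every
field and for every known monotone-algebraic device separately. [PitassiRobere2018 §1 (cross-field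
separations); GoosKamathRobereSokolov2019; BussGrigorievImpagliazzoPitassi2001] -/
theorem stub_crossCharacteristic (w a b : ℕ) (F : ℕ → BCSP w) (hsize : PolySize a F)
    (hunsat : ∀ᶠ N : ℕ in atTop, ¬ (F N).Sat)
    (hhard : ∃ ε : ℝ, 0 < ε ∧ ∀ᶠ N : ℕ in atTop, ∀ (𝔽 : Type) [Field 𝔽],
      ¬ PC.RefutableInDegree (axiomPolys 𝔽 (F N)) ⌊(N : ℝ) ^ ε⌋₊)
    (hsingle : ∀ (𝔽 : Type) [Field 𝔽], HardAgainst (spanBasis 𝔽) (LiftIdx F b) (liftFamily F b)) :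
    HardAgainst allSpanBasis (LiftIdx F b) (liftFamily F b) := by
  sorry

/-- **stub_permLinearisation — (O2)+(O3), PERM gates add nothing to mixed-field span circuits
(RESIDUE; = Linearisation Conjecture of crux idea `invariant-module-linearisation`, circuit form).**
For EVERY function family: hardness against `{∧₂,∨₂} ∪ SPAN_*` implies hardness against
`{∧₂,∨₂} ∪ SPAN_* ∪ PERM` (same polynomial budgets). Equivalent in substance to: every PERM_s gate
(membership of `τ` in `⟨σ_i : v_i = 1⟩ ≤ Sym(s)`) is computed by a `poly(s)`-size circuit over
`{∧₂,∨₂} ∪ SPAN_*(poly s)` (then substitute gate by gate; conversely take `f` = the gate family).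
Evidence: `τ ∈ ⟨H_X⟩` iff `τ` passes all fixed-vector tests on permutation/section modules
(`mem_closure_iff_tupleTest`, triage-verified), each test an AND of span programs, guarded tests
`[H_X ⊄ L] ∨ [Fix_W(H_X) ⊆ Fix_W(τ)]` are `∨` of variables and a span program; the conjecture is that
polynomially many section modules of polynomial dimension suffice (abelian `ℤ/p^k` parts need
Loewy-length ≥ 3 modules, e.g. `𝔽₂[Γ]/J³`, still polynomial). Why it might fail: a permutation-group
membership function with no poly mixed-field monotone span circuit — candidates `(ℤ/4)^t ↪ Sym(4t)`
cyclic pools (the Lichter2023 motive; `CompositeModulusDegree` shadows it) and wreath/diagonal pools at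
`d = 12–16`; a kill would itself be a new monotone separation (group membership vs all field-linear
algebra). [FurstHopcroftLuks1980; BabaiLuksSeress1987; Lichter2023; card invariant-module-linearisation] -/
theorem stub_permLinearisation (ι : ℕ → Type) (f : ∀ N, (ι N → Bool) → Bool)
    (h : HardAgainst allSpanBasis ι f) : HardAgainst allSpanPermBasis ι f := by
  sorry

/-- **stub_grankDoor — GRANK gates on the planted instance (RESIDUE; Valiant-hard, NOT claimed).**
For the all-field-hard planted family, hardness against `{∧₂,∨₂} ∪ SPAN_* ∪ PERM` upgrades to hardness
with GRANK gates (generic-rank thresholds of affine symbolic `d × d` pencils over any field, `d ≤ N^c`)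
added. Calibration: already ONE GRANK gate computing `liftSat` i.o. would be excluded, i.e. (Disproof
(b): `exists_oneGRankGate_of_shadow`) no polynomial whose monotone shadow is lifted CSP-SAT — e.g. the
planted polynomial `Σ_α Π_j s_{(j, α ∘ vars j)}`, a permanent-like VNP family for PHP-type `F` — has
determinantal complexity `≤ N^c`: a VNP ⊄ VBP-strength statement in every characteristic, exactly as the
headline `dc_cliquePoly_superpolynomial_of_linAlgGateBlind` prices the crux itself. Deliberately NOT
stated for general families (`GRANK ⊆ poly {∧,∨}+SPAN+PERM circuits` would put bipartite perfect
matching into monotone span circuits — open and doubtful). Repair pointer recorded by the triage: a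
planner-level re-typing of GRANK to read-≤2 pencils (`IsReadK M 2`) voids the calibration. Why it might
fail: it does not fail cheaply (tame GRANK is P/poly-evaluable; wild constants need an actual small
affine pencil whose determinant lies in the lifted-CSP-SAT monomial ideal and touches every minterm —
none known); it is simply as hard as Valiant's hypothesis. [Valiant1979; Burgisser2000; Disproof (b);
HrubesJoglekar2025] -/
theorem stub_grankDoor (w a b : ℕ) (F : ℕ → BCSP w) (hsize : PolySize a F)
    (hunsat : ∀ᶠ N : ℕ in atTop, ¬ (F N).Sat)
    (hhard : ∃ ε : ℝ, 0 < ε ∧ ∀ᶠ N : ℕ in atTop, ∀ (𝔽 : Type) [Field 𝔽],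
      ¬ PC.RefutableInDegree (axiomPolys 𝔽 (F N)) ⌊(N : ℝ) ^ ε⌋₊)
    (h : HardAgainst allSpanPermBasis (LiftIdx F b) (liftFamily F b)) :
    HardAgainst allSpanLinBasis (LiftIdx F b) (liftFamily F b) := by
  sorry

/-- **stub_labelledRankMeasure — Gál's rank-one decomposition with arbitrary labels (PROVABLE NOW,
M).** See `LabelledRankMeasure`. Mathlib: `Submodule.exists_dual_map_eq_bot_of_notMem` (the functional
`d_v`), `Submodule.mem_span_iff_exists_fun`-type lemmas for `c(u)`, `Matrix.rank_add_le`-type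
subadditivity over the finite sum, `Matrix.rank` of `diag · M · diag ≤ rank M`. [Gal2001, Thm 3.1 with
labels] -/
theorem stub_labelledRankMeasure : LabelledRankMeasure := by
  sorry

/-! ## The composition: the seven stubs prove the crux -/

/-- **THE SKELETON (composition).** The seven registered stubs prove the crux: hard CSP family
(`stub_allFieldHardCSP`) → per-field span hardness of its lift (`stub_spanDagLift`, fed by
`stub_labelledRankMeasure`) → mixed-field (`stub_crossCharacteristic`) → + PERM
(`stub_permLinearisation`) → + GRANK (`stub_grankDoor`) → antitone to the crux basis
(`cruxBasis_subset_allSpanLinBasis`, `HardAgainst.anti`) → planting (`stub_transfer`). The proof is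
real; the only `sorry`s are inside the seven `stub_*` (see `LinAlgGateBlind_of_hypotheses` below for
the same proof with the stub STATEMENTS as hypotheses, axioms `{propext, Classical.choice, Quot.sound}`).
[folklore] -/
theorem LinAlgGateBlind_of : LinAlgGateBlind := by
  -- S2: the all-field-hard bounded-arity CSP family
  obtain ⟨w, a, F, hsize, hunsat, ε, hε, hhard⟩ := stub_allFieldHardCSP
  -- S3 (fed by S7): a field-independent gadget exponent and single-field span hardness, field by field
  obtain ⟨b, hb⟩ := stub_spanDagLift stub_labelledRankMeasure w a
  have hsingle : ∀ (𝔽 : Type) [Field 𝔽],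
      HardAgainst (spanBasis 𝔽) (LiftIdx F b) (liftFamily F b) :=
    fun 𝔽 _ => hb 𝔽 F hsize hunsat ⟨ε, hε, hhard.mono fun N hN => hN 𝔽⟩
  -- S4: mixed characteristics
  have hall : HardAgainst allSpanBasis (LiftIdx F b) (liftFamily F b) :=
    stub_crossCharacteristic w a b F hsize hunsat ⟨ε, hε, hhard⟩ hsingle
  -- S5: PERM gates (linearisation)
  have hperm : HardAgainst allSpanPermBasis (LiftIdx F b) (liftFamily F b) :=
    stub_permLinearisation _ _ hall
  -- S6: GRANK gates on the planted instance
  have hlin : HardAgainst allSpanLinBasis (LiftIdx F b) (liftFamily F b) :=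
    stub_grankDoor w a b F hsize hunsat ⟨ε, hε, hhard⟩ hperm
  -- the crux's basis is a sub-basis; S1: plant into CLIQUE
  exact stub_transfer w a b F hsize (hlin.anti cruxBasis_subset_allSpanLinBasis)

/-- **Composition, hypotheses form** (the statements of the seven `stub_*` copied literally as
hypotheses; same proof as `LinAlgGateBlind_of`, no `sorry` anywhere in its cone — this is the
certificate that the skeleton's logic is sound independently of the stubs). [folklore] -/
theorem LinAlgGateBlind_of_hypotheses
    (h_transfer : ∀ (w a b : ℕ) (F : ℕ → BCSP w), PolySize a F →
      HardAgainst cruxBasis (LiftIdx F b) (liftFamily F b) → LinAlgGateBlind)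
    (h_hardCSP : ∃ (w a : ℕ) (F : ℕ → BCSP w), PolySize a F ∧
      (∀ᶠ N : ℕ in atTop, ¬ (F N).Sat) ∧
      ∃ ε : ℝ, 0 < ε ∧ ∀ᶠ N : ℕ in atTop, ∀ (𝔽 : Type) [Field 𝔽],
        ¬ PC.RefutableInDegree (axiomPolys 𝔽 (F N)) ⌊(N : ℝ) ^ ε⌋₊)
    (h_dagLift : LabelledRankMeasure → ∀ (w a : ℕ), ∃ b : ℕ,
      ∀ (𝔽 : Type) [Field 𝔽] (F : ℕ → BCSP w), PolySize a F → (∀ᶠ N : ℕ in atTop, ¬ (F N).Sat) →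
        (∃ ε : ℝ, 0 < ε ∧ ∀ᶠ N : ℕ in atTop,
          ¬ PC.RefutableInDegree (axiomPolys 𝔽 (F N)) ⌊(N : ℝ) ^ ε⌋₊) →
        HardAgainst (spanBasis 𝔽) (LiftIdx F b) (liftFamily F b))
    (h_cross : ∀ (w a b : ℕ) (F : ℕ → BCSP w), PolySize a F →
      (∀ᶠ N : ℕ in atTop, ¬ (F N).Sat) →
      (∃ ε : ℝ, 0 < ε ∧ ∀ᶠ N : ℕ in atTop, ∀ (𝔽 : Type) [Field 𝔽],
        ¬ PC.RefutableInDegree (axiomPolys 𝔽 (F N)) ⌊(N : ℝ) ^ ε⌋₊) →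
      (∀ (𝔽 : Type) [Field 𝔽], HardAgainst (spanBasis 𝔽) (LiftIdx F b) (liftFamily F b)) →
      HardAgainst allSpanBasis (LiftIdx F b) (liftFamily F b))
    (h_perm : ∀ (ι : ℕ → Type) (f : ∀ N, (ι N → Bool) → Bool),
      HardAgainst allSpanBasis ι f → HardAgainst allSpanPermBasis ι f)
    (h_grank : ∀ (w a b : ℕ) (F : ℕ → BCSP w), PolySize a F →
      (∀ᶠ N : ℕ in atTop, ¬ (F N).Sat) →
      (∃ ε : ℝ, 0 < ε ∧ ∀ᶠ N : ℕ in atTop, ∀ (𝔽 : Type) [Field 𝔽],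
        ¬ PC.RefutableInDegree (axiomPolys 𝔽 (F N)) ⌊(N : ℝ) ^ ε⌋₊) →
      HardAgainst allSpanPermBasis (LiftIdx F b) (liftFamily F b) →
      HardAgainst allSpanLinBasis (LiftIdx F b) (liftFamily F b))
    (h_LRM : LabelledRankMeasure) :
    LinAlgGateBlind := by
  obtain ⟨w, a, F, hsize, hunsat, ε, hε, hhard⟩ := h_hardCSP
  obtain ⟨b, hb⟩ := h_dagLift h_LRM w a
  have hsingle : ∀ (𝔽 : Type) [Field 𝔽],
      HardAgainst (spanBasis 𝔽) (LiftIdx F b) (liftFamily F b) :=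
    fun 𝔽 _ => hb 𝔽 F hsize hunsat ⟨ε, hε, hhard.mono fun N hN => hN 𝔽⟩
  have hall : HardAgainst allSpanBasis (LiftIdx F b) (liftFamily F b) :=
    h_cross w a b F hsize hunsat ⟨ε, hε, hhard⟩ hsingle
  have hperm : HardAgainst allSpanPermBasis (LiftIdx F b) (liftFamily F b) := h_perm _ _ hall
  have hlin : HardAgainst allSpanLinBasis (LiftIdx F b) (liftFamily F b) :=
    h_grank w a b F hsize hunsat ⟨ε, hε, hhard⟩ hperm
  exact h_transfer w a b F hsize (hlin.anti cruxBasis_subset_allSpanLinBasis)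

/-- The hypotheses form applied to the stubs IS the skeleton theorem (types match literally). -/
example : LinAlgGateBlind :=
  LinAlgGateBlind_of_hypotheses stub_transfer stub_allFieldHardCSP stub_spanDagLift
    stub_crossCharacteristic stub_permLinearisation stub_grankDoor stub_labelledRankMeasure

end

end Summit.PneNP.PneNP.Cruxes.LinAlgGateBlind.PermDoorLiftedClosurePrograms
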